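import Literature.Geometry.Symplectic.SteinBallLegendrian
import Literature.Geometry.Kaehler.ManifoldFormsPullback
import Literature.Topology.FourManifolds.ClosedBall
import Mathlib.Geometry.Manifold.Instances.Sphere
import HarnessLib

/-!
# The standard open book of `S³` (1/3): the contact form `α = ⟪J₀ z, ·⟫|_{S³}`, coordinates, the tube

First of three files constructing the FIRST inhabitant of the tree's open-book interface
(`OpenBook`, `OpenBook.Supports`, `OpenBook.IsPlanar`, `PlanarContactBoundary` of
`PlanarContactBoundary.lean`): the standard (disc) open book of the unit sphere `S³ ⊂ ℂ²` — binding
the unknot `B = {z₁ = 0}`, fibration `π = z₁/‖z₁‖ : S³ ∖ B → S¹`, pages the open discs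
`{arg z₁ = c}` — supports the standard contact structure `ξ_std = ker (r₁² dθ₁ + r₂² dθ₂)`, the
complex tangencies of `S³ = ∂B⁴` (Etnyre 2006, §2, Example "`U = {z₁ = 0}` … `π_U = z₁/|z₁|`" and
§3, Example "this open book supports the standard contact structure"; Wendl 2020, §5.1, Fig. 5.1;
Geiges 2008, Ex. 2.1.7 for `α`).  Consequence (file 3/3): the contact boundary of the standard Stein
ball `(𝔻⁴, J₀, |z|²)` is planar, `PlanarContactBoundary steinStructureClosedBall`.  This file:
* `SphereOpenBook.D y` — the differential of the inclusion `S³ ↪ ℝ⁴` (Mathlib's `mfderiv` of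
  `Subtype.val`), range `y^⊥`, injective;
* `SphereOpenBook.ambForm` — the ambient 1-form `A_x = ⟪J₀ x, ·⟫` on `ℝ⁴ = ℂ²`, `dA = 2ω₀`;
* `SphereOpenBook.girouxForm` — **the standard contact form `α = A|_{S³}`** as a smooth 1-form on
  the manifold `S³` (`Literature.Geometry.Kaehler.MForm`, pull-back along the inclusion):
  `α_y(v) = ⟪J₀ y, D_y v⟫`, `(dα)_y(u, v) = 2⟪J₀ D_y u, D_y v⟫` (`mextDeriv_girouxForm_apply`);
* the coordinates `z₁ = pr₁`, `z₂ = pr₂ : ℂ² → ℂ`, the juxtaposition `join : ℂ × ℂ → ℂ²`;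
* the binding tube `SphereOpenBook.tube : S¹ × ℝ² → S³`, `(p, w) ↦ (w, p)/√(1 + ‖w‖²)`, smooth,
  with `z₂ ≠ 0` on its image.

Adapted verbatim (namespace and imports only) from the standing disprover's crux work file
`Summits/SmoothPoincare4/SmoothPoincare4/Cruxes/PlanarBisectionRigidity/Disproof.lean`, §5a
(gen 3, v7.2, sorry-free), where it was first machine-checked; moved here to be importable.

## References

* J. B. Etnyre, *Lectures on open book decompositions and contact structures*, Clay Math. Proc. 5
  (2006), §2–§3 (arXiv:math/0409402). [Etnyre2006]
* C. Wendl, *Lectures on Contact 3-Manifolds, Holomorphic Curves and Intersection Theory* (2020),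
  §5.1, Fig. 5.1. [Wendl2020]
* H. Geiges, *An Introduction to Contact Topology* (2008), Ex. 2.1.7. [Geiges2008]
-/

noncomputable section

open scoped Manifold ContDiff Topology RealInnerProductSpace
open Set Function

namespace Literature.Geometry.Symplectic

namespace SphereOpenBook

open Literature.Geometry.Kaehler Literature.Topology.FourManifolds

/-- Local notation: `ℝ⁴ = ℂ²`. -/
local notation "E4" => EuclideanSpace ℝ (Fin 4)
/-- Local notation: `ℝ³` (the chart model of `S³`). -/
local notation "E3" => EuclideanSpace ℝ (Fin 3)
/-- Local notation: `ℝ² = ℂ`. -/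
local notation "E2" => EuclideanSpace ℝ (Fin 2)
/-- Local notation: `ℝ¹` (the chart model of `S¹`). -/
local notation "E1" => EuclideanSpace ℝ (Fin 1)
/-- Local notation: the unit sphere `S³ ⊂ ℂ²`. -/
local notation "S3" => (Metric.sphere (0 : EuclideanSpace ℝ (Fin 4)) 1)
/-- Local notation: the unit circle `S¹ ⊂ ℂ`. -/
local notation "S1" => (Metric.sphere (0 : EuclideanSpace ℝ (Fin 2)) 1)
/-- Local notation: the standard complex structure `J₀` of `ℝ⁴ = ℂ²`. -/
local notation "J₀" => stdComplexStructure

attribute [local instance] Literature.Topology.FourManifolds.fact_finrank_euclideanSpace_succ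

/-! ### The differential of the inclusion `S³ ⊂ ℝ⁴` -/

/-- **`D_y`: the differential at `y` of the inclusion `S³ ↪ ℝ⁴`**, from the chart model `ℝ³` of
`T_yS³` to the ambient `ℝ⁴` (Mathlib's `mfderiv` of `Subtype.val`). [folklore] -/
def D (y : S3) : E3 →L[ℝ] E4 :=
  mfderiv (𝓡 3) 𝓘(ℝ, E4) (Subtype.val : S3 → E4) y

/-- The range of `D_y` is the orthogonal complement of `y` (Mathlib). [folklore] -/
theorem range_D (y : S3) : (D y).range = (ℝ ∙ (y : E4))ᗮ :=
  range_mfderiv_coe_sphere (n := 3) y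

/-- `D_y` is injective (Mathlib). [folklore] -/
theorem D_injective (y : S3) : Injective (D y) :=
  mfderiv_coe_sphere_injective (n := 3) y

/-- Tangent vectors are orthogonal to the position vector: `⟪y, D_y v⟫ = 0`. [folklore] -/
theorem inner_D (y : S3) (v : E3) : ⟪(y : E4), D y v⟫ = 0 := by
  have h : D y v ∈ (D y).range := ⟨v, rfl⟩
  rw [range_D] at h
  exact (Submodule.mem_orthogonal_singleton_iff_inner_right).1 h

/-- Every vector orthogonal to `y` is a tangent vector: `⟪y, N⟫ = 0 → ∃ v, D_y v = N`. [folklore] -/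
theorem exists_D_eq (y : S3) {N : E4} (h : ⟪(y : E4), N⟫ = 0) : ∃ v : E3, D y v = N := by
  have hN : N ∈ (D y).range := by
    rw [range_D]
    exact (Submodule.mem_orthogonal_singleton_iff_inner_right).2 h
  exact hN

/-- `D_y v = 0 ↔ v = 0`. [folklore] -/
theorem D_eq_zero_iff (y : S3) (v : E3) : D y v = 0 ↔ v = 0 :=
  ⟨fun h => D_injective y (by rw [h, map_zero]), fun h => by rw [h, map_zero]⟩

/-! ### The ambient 1-form `A_x = ⟪J₀ x, ·⟫` and its exterior derivative `2ω₀` -/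

/-- The inner product on `ℝ⁴` in coordinates. [folklore] -/
theorem inner_eq_sum (x y : E4) : ⟪x, y⟫ = x 0 * y 0 + x 1 * y 1 + x 2 * y 2 + x 3 * y 3 := by
  simp [PiLp.inner_apply, Fin.sum_univ_four, mul_comm]

/-- `⟪J₀ x, v⟫` in coordinates. [folklore] -/
theorem inner_J_eq (x v : E4) :
    ⟪J₀ x, v⟫ = x 0 * v 1 - x 1 * v 0 + x 2 * v 3 - x 3 * v 2 := by
  rw [inner_eq_sum]
  simp
  ring

/-- **The ambient 1-form `A_x(v) = ⟪J₀ x, v⟫`** on `ℝ⁴` (half of `-d^ℂ |z|²`; the standard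
contact form of `S³` is its restriction), as a form in Mathlib's sense. [folklore] -/
def ambForm : E4 → E4 [⋀^Fin 1]→L[ℝ] ℝ := fun x =>
  ContinuousAlternatingMap.ofSubsingleton ℝ E4 ℝ (0 : Fin 1) (innerSL ℝ (J₀ x))

/-- `A_x(v) = ⟪J₀ x, v₀⟫`. [folklore] -/
@[simp] theorem ambForm_apply (x : E4) (v : Fin 1 → E4) : ambForm x v = ⟪J₀ x, v 0⟫ :=
  rfl

/-- `A` as a linear map `ℝ⁴ → (1-forms)` (it is linear in the point). [folklore] -/
def ambFormLin : E4 →ₗ[ℝ] (E4 [⋀^Fin 1]→L[ℝ] ℝ) where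
  toFun := ambForm
  map_add' x y := by ext v; simp [inner_add_left]
  map_smul' c x := by ext v; simp [inner_smul_left]

/-- `A` as a continuous linear map. [folklore] -/
def ambFormCLM : E4 →L[ℝ] (E4 [⋀^Fin 1]→L[ℝ] ℝ) :=
  LinearMap.toContinuousLinearMap ambFormLin

/-- `ambFormCLM` is `ambForm`. [folklore] -/
@[simp] theorem ambFormCLM_apply (x : E4) : ambFormCLM x = ambForm x := rfl

/-- `A` is `C^∞` (it is linear). [folklore] -/
theorem contDiff_ambForm : ContDiff ℝ ∞ ambForm :=
  ambFormCLM.contDiff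

/-- `A` is differentiable. [folklore] -/
theorem differentiableAt_ambForm (x : E4) : DifferentiableAt ℝ ambForm x :=
  (ambFormCLM.differentiable : Differentiable ℝ ambForm) x

/-- The coefficient functional `x ↦ A_x(c) = ⟪J₀ x, c⟫` is the continuous linear map
`-⟪J₀ c, ·⟫`. [folklore] -/
theorem ambForm_apply_const_eq (c : Fin 1 → E4) :
    (fun x : E4 => ambForm x c) = fun x => -(innerSL ℝ (J₀ (c 0))) x := by
  funext x
  rw [ambForm_apply, innerSL_apply_apply, inner_J_eq, inner_J_eq]
  ring

/-- **`dA = 2ω₀`**: `(dA)_x(u, v) = 2⟪J₀ u, v⟫` (Mathlib's normalisation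
`dα(v₀, v₁) = ∂_{v₀}α(v₁) - ∂_{v₁}α(v₀)`). [folklore] -/
theorem extDeriv_ambForm (x : E4) (v : Fin 2 → E4) :
    extDeriv ambForm x v = 2 * ⟪J₀ (v 0), v 1⟫ := by
  rw [extDeriv_apply (differentiableAt_ambForm x), Fin.sum_univ_two]
  have e0 : Fin.removeNth (0 : Fin 2) v 0 = v 1 := rfl
  have e1 : Fin.removeNth (1 : Fin 2) v 0 = v 0 := rfl
  have h0 : (fun x : E4 => ambForm x (Fin.removeNth 0 v)) =
      fun x => -(innerSL ℝ (J₀ (v 1))) x := by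
    rw [ambForm_apply_const_eq, e0]
  have h1 : (fun x : E4 => ambForm x (Fin.removeNth 1 v)) =
      fun x => -(innerSL ℝ (J₀ (v 0))) x := by
    rw [ambForm_apply_const_eq, e1]
  rw [h0, h1, fderiv_fun_neg, fderiv_fun_neg, ContinuousLinearMap.fderiv, ContinuousLinearMap.fderiv]
  simp only [Fin.val_zero, pow_zero, one_smul, Fin.val_one, pow_one, neg_smul,
    neg_apply, innerSL_apply_apply]
  simp only [inner_J_eq]
  ring

/-! ### The restriction `α = A|_{S³}` (the Giroux form) and `dα` -/

/-- **The standard contact form of `S³`**, `α = A|_{S³}`, as a 1-form on the manifold `S³`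
(pull-back of `A` along the inclusion). [folklore] -/
def girouxForm : MForm (𝓡 3) S3 ℝ 1 :=
  MForm.pullback (I' := 𝓘(ℝ, E4)) (𝓡 3) (Subtype.val : S3 → E4) ambForm

/-- `α_y(v) = ⟪J₀ y, D_y v⟫`. [folklore] -/
theorem girouxForm_apply (y : S3) (v : E3) : girouxForm y ![v] = ⟪J₀ (y : E4), D y v⟫ :=
  rfl

/-- In the flat case the chart representative of a form is the form itself. [folklore] -/
theorem inChart_eq_self_flat {k : ℕ} (β : MForm 𝓘(ℝ, E4) E4 ℝ k) (z : E4) : β.inChart z = β := by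
  funext y
  ext v
  simp [MForm.inChart_apply]
  rfl

/-- In the flat case a `C^∞` form is smooth at every point. [folklore] -/
theorem smoothAt_flat_of_contDiff {k : ℕ} {β : E4 → E4 [⋀^Fin k]→L[ℝ] ℝ} (h : ContDiff ℝ ∞ β)
    (z : E4) : MForm.SmoothAt (I := 𝓘(ℝ, E4)) β z := by
  rw [MForm.SmoothAt, inChart_eq_self_flat]
  simp only [modelWithCornersSelf_coe, range_id, extChartAt_self_apply]
  exact h.contDiffAt.contDiffWithinAt

/-- The inclusion `S³ ↪ ℝ⁴` is `C^∞` near every point (Mathlib). [folklore] -/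
theorem eventually_contMDiffAt_val (y : S3) :
    ∀ᶠ z in 𝓝 y, ContMDiffAt (𝓡 3) 𝓘(ℝ, E4) ∞ (Subtype.val : S3 → E4) z :=
  Filter.Eventually.of_forall fun z => (contMDiff_coe_sphere (n := 3)) z

/-- **`α` is a `C^∞` form on `S³`.** [folklore] -/
theorem isSmoothForm_girouxForm : IsSmoothForm girouxForm := fun y =>
  MForm.SmoothAt.pullback (eventually_contMDiffAt_val y) (smoothAt_flat_of_contDiff contDiff_ambForm _)

/-- **`(dα)_y(u, v) = 2⟪J₀ D_y u, D_y v⟫`** (naturality of `d` + `dA = 2ω₀`). [folklore] -/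
theorem mextDeriv_girouxForm_apply (y : S3) (u v : E3) :
    mextDeriv girouxForm y ![u, v] = 2 * ⟪J₀ (D y u), D y v⟫ := by
  rw [girouxForm, mextDeriv_pullback_apply (eventually_contMDiffAt_val y)
    (smoothAt_flat_of_contDiff contDiff_ambForm _), MForm.pullback_apply, mextDeriv_eq_extDeriv]
  exact extDeriv_ambForm (y : E4) _


/-! ### The coordinates `z₁ = (x₀, x₁)` and `z₂ = (x₂, x₃)` of `ℝ⁴ = ℂ²` -/

/-- `‖a‖² = a₀² + a₁²` on `ℝ²` (coordinates of the inner product: the tree's `inner_fin_two`).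
[folklore] -/
theorem norm_sq_eq₂ (a : E2) : ‖a‖ ^ 2 = a 0 * a 0 + a 1 * a 1 := by
  rw [← real_inner_self_eq_norm_sq, inner_fin_two]

/-- `‖x‖² = x₀² + x₁² + x₂² + x₃²` on `ℝ⁴`. [folklore] -/
theorem norm_sq_eq₄ (x : E4) : ‖x‖ ^ 2 = x 0 * x 0 + x 1 * x 1 + x 2 * x 2 + x 3 * x 3 := by
  rw [← real_inner_self_eq_norm_sq, inner_eq_sum]

/-- The first complex coordinate `z₁ = (x₀, x₁)`, as a linear map. [folklore] -/
def pr₁Lin : E4 →ₗ[ℝ] E2 where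
  toFun x := !₂[x 0, x 1]
  map_add' x y := by ext i; fin_cases i <;> simp
  map_smul' c x := by ext i; fin_cases i <;> simp

/-- **The first complex coordinate `z₁ : ℂ² → ℂ`.** [folklore] -/
def pr₁ : E4 →L[ℝ] E2 :=
  LinearMap.toContinuousLinearMap pr₁Lin

/-- The second complex coordinate `z₂ = (x₂, x₃)`, as a linear map. [folklore] -/
def pr₂Lin : E4 →ₗ[ℝ] E2 where
  toFun x := !₂[x 2, x 3]
  map_add' x y := by ext i; fin_cases i <;> simp
  map_smul' c x := by ext i; fin_cases i <;> simp

/-- **The second complex coordinate `z₂ : ℂ² → ℂ`.** [folklore] -/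
def pr₂ : E4 →L[ℝ] E2 :=
  LinearMap.toContinuousLinearMap pr₂Lin

/-- `(z₁)₀ = x₀`. [folklore] -/
@[simp] theorem pr₁_apply_zero (x : E4) : pr₁ x 0 = x 0 := rfl
/-- `(z₁)₁ = x₁`. [folklore] -/
@[simp] theorem pr₁_apply_one (x : E4) : pr₁ x 1 = x 1 := rfl
/-- `(z₂)₀ = x₂`. [folklore] -/
@[simp] theorem pr₂_apply_zero (x : E4) : pr₂ x 0 = x 2 := rfl
/-- `(z₂)₁ = x₃`. [folklore] -/
@[simp] theorem pr₂_apply_one (x : E4) : pr₂ x 1 = x 3 := rfl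

/-- `‖x‖² = ‖z₁‖² + ‖z₂‖²`. [folklore] -/
theorem norm_sq_eq_add (x : E4) : ‖x‖ ^ 2 = ‖pr₁ x‖ ^ 2 + ‖pr₂ x‖ ^ 2 := by
  rw [norm_sq_eq₄, norm_sq_eq₂, norm_sq_eq₂]
  simp only [pr₁_apply_zero, pr₁_apply_one, pr₂_apply_zero, pr₂_apply_one]
  ring

/-- On the sphere, `‖z₁‖² + ‖z₂‖² = 1`. [folklore] -/
theorem norm_sq_pr_add (y : S3) : ‖pr₁ (y : E4)‖ ^ 2 + ‖pr₂ (y : E4)‖ ^ 2 = 1 := by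
  rw [← norm_sq_eq_add, norm_eq_of_mem_sphere y, one_pow]

/-- **Juxtaposition `(a, b) ↦ (a₀, a₁, b₀, b₁)`: `ℂ × ℂ → ℂ²`**, as a linear map. [folklore] -/
def joinLin : E2 × E2 →ₗ[ℝ] E4 where
  toFun q := !₂[q.1 0, q.1 1, q.2 0, q.2 1]
  map_add' q q' := by ext i; fin_cases i <;> simp
  map_smul' c q := by ext i; fin_cases i <;> simp

/-- Juxtaposition as a continuous linear map. [folklore] -/
def join : E2 × E2 →L[ℝ] E4 :=
  LinearMap.toContinuousLinearMap joinLin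

/-- `(a, b)₀ = a₀`. [folklore] -/
@[simp] theorem join_apply_zero (q : E2 × E2) : join q 0 = q.1 0 := rfl
/-- `(a, b)₁ = a₁`. [folklore] -/
@[simp] theorem join_apply_one (q : E2 × E2) : join q 1 = q.1 1 := rfl
/-- `(a, b)₂ = b₀`. [folklore] -/
@[simp] theorem join_apply_two (q : E2 × E2) : join q 2 = q.2 0 := rfl
/-- `(a, b)₃ = b₁`. [folklore] -/
@[simp] theorem join_apply_three (q : E2 × E2) : join q 3 = q.2 1 := rfl

/-- `z₁ (a, b) = a`. [folklore] -/
@[simp] theorem pr₁_join (q : E2 × E2) : pr₁ (join q) = q.1 := by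
  ext i; fin_cases i <;> rfl

/-- `z₂ (a, b) = b`. [folklore] -/
@[simp] theorem pr₂_join (q : E2 × E2) : pr₂ (join q) = q.2 := by
  ext i; fin_cases i <;> rfl

/-- `x = (z₁, z₂)` juxtaposed. [folklore] -/
theorem join_pr (x : E4) : join (pr₁ x, pr₂ x) = x := by
  ext i; fin_cases i <;> rfl

/-- `‖(a, b)‖² = ‖a‖² + ‖b‖²` for the juxtaposition. [folklore] -/
theorem norm_sq_join (q : E2 × E2) : ‖join q‖ ^ 2 = ‖q.1‖ ^ 2 + ‖q.2‖ ^ 2 := by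
  rw [norm_sq_eq_add, pr₁_join, pr₂_join]

/-! ### The binding tube `S¹ × ℝ² → S³`, `(p, w) ↦ (w, p)/√(1 + ‖w‖²)` -/

/-- The radial rescaling `s(w) = 1/√(1 + ‖w‖²)`. [folklore] -/
def tubeScale (w : E2) : ℝ :=
  (√(1 + ‖w‖ ^ 2))⁻¹

/-- `0 < 1 + ‖w‖²`. [folklore] -/
theorem one_add_norm_sq_pos (w : E2) : 0 < 1 + ‖w‖ ^ 2 := by positivity

/-- `s(w) > 0`. [folklore] -/
theorem tubeScale_pos (w : E2) : 0 < tubeScale w :=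
  inv_pos.2 (Real.sqrt_pos.2 (one_add_norm_sq_pos w))

/-- `s(w)² (1 + ‖w‖²) = 1`. [folklore] -/
theorem tubeScale_sq_mul (w : E2) : tubeScale w ^ 2 * (1 + ‖w‖ ^ 2) = 1 := by
  rw [tubeScale, inv_pow, Real.sq_sqrt (one_add_norm_sq_pos w).le,
    inv_mul_cancel₀ (one_add_norm_sq_pos w).ne']

/-- `s(0) = 1`. [folklore] -/
@[simp] theorem tubeScale_zero : tubeScale 0 = 1 := by
  simp [tubeScale]

/-- `s` is `C^∞`. [folklore] -/
theorem contDiff_tubeScale : ContDiff ℝ ∞ tubeScale := by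
  have h1 : ContDiff ℝ ∞ fun w : E2 => 1 + ‖w‖ ^ 2 := contDiff_const.add (contDiff_norm_sq ℝ)
  have h2 : ContDiff ℝ ∞ fun w : E2 => √(1 + ‖w‖ ^ 2) :=
    h1.sqrt fun w => (one_add_norm_sq_pos w).ne'
  exact h2.inv fun w => (Real.sqrt_pos.2 (one_add_norm_sq_pos w)).ne'

/-- **The tube in ambient coordinates**: `(p, w) ↦ s(w) · (w, p) ∈ ℂ²` (`z₁ = s w`, `z₂ = s p`).
[folklore] -/
def tubeAmb (q : E2 × E2) : E4 :=
  tubeScale q.2 • join (q.2, q.1)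

/-- `z₁` of the ambient tube: `s(w) w`. [folklore] -/
theorem pr₁_tubeAmb (q : E2 × E2) : pr₁ (tubeAmb q) = tubeScale q.2 • q.2 := by
  simp [tubeAmb]

/-- `z₂` of the ambient tube: `s(w) p`. [folklore] -/
theorem pr₂_tubeAmb (q : E2 × E2) : pr₂ (tubeAmb q) = tubeScale q.2 • q.1 := by
  simp [tubeAmb]

/-- `tubeAmb` is `C^∞`. [folklore] -/
theorem contDiff_tubeAmb : ContDiff ℝ ∞ tubeAmb :=
  (contDiff_tubeScale.comp contDiff_snd).smul (join.contDiff.comp (contDiff_snd.prodMk contDiff_fst))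

/-- On `‖p‖ = 1` the tube lands in `S³`: `‖s(w)(w, p)‖² = s²(‖w‖² + 1) = 1`. [folklore] -/
theorem norm_tubeAmb (p : S1) (w : E2) : ‖tubeAmb ((p : E2), w)‖ = 1 := by
  have h : ‖tubeAmb ((p : E2), w)‖ ^ 2 = 1 := by
    rw [tubeAmb, norm_smul, mul_pow, Real.norm_eq_abs, sq_abs, norm_sq_join]
    simp only [norm_eq_of_mem_sphere p, one_pow]
    rw [add_comm]
    exact tubeScale_sq_mul w
  exact (pow_eq_one_iff_of_nonneg (norm_nonneg _) two_ne_zero).1 h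

/-- The ambient tube of a point of `S¹ × ℝ²` lies on `S³`. [folklore] -/
theorem tubeAmb_mem (q : S1 × E2) : tubeAmb ((q.1 : E2), q.2) ∈ S3 :=
  mem_sphere_zero_iff_norm.2 (norm_tubeAmb q.1 q.2)

/-- **The binding tube `S¹ × ℝ² → S³`**, `(p, w) ↦ (w, p)/√(1 + ‖w‖²)`; its core `w = 0` is the
binding circle `{z₁ = 0}`. [folklore] -/
def tube : S1 × E2 → S3 :=
  Set.codRestrict (fun q : S1 × E2 => tubeAmb ((q.1 : E2), q.2)) _ tubeAmb_mem

/-- The tube read in `ℂ²` is the ambient tube. [folklore] -/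
@[simp] theorem coe_tube (q : S1 × E2) : (tube q : E4) = tubeAmb ((q.1 : E2), q.2) := rfl

/-- `z₁ (tube (p, w)) = s(w) w`. [folklore] -/
theorem pr₁_tube (p : S1) (w : E2) : pr₁ (tube (p, w) : E4) = tubeScale w • w := by
  rw [coe_tube, pr₁_tubeAmb]

/-- `z₂ (tube (p, w)) = s(w) p`. [folklore] -/
theorem pr₂_tube (p : S1) (w : E2) : pr₂ (tube (p, w) : E4) = tubeScale w • (p : E2) := by
  rw [coe_tube, pr₂_tubeAmb]

/-- The tube is `C^∞`. [folklore] -/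
theorem contMDiff_tube : ContMDiff ((𝓡 1).prod 𝓘(ℝ, E2)) (𝓡 3) ∞ tube :=
  (contDiff_tubeAmb.contMDiff.comp
    (((contMDiff_coe_sphere (n := 1)).comp contMDiff_fst).prodMk_space contMDiff_snd)).codRestrict_sphere _

/-- The tube is continuous. [folklore] -/
theorem continuous_tube : Continuous tube :=
  contMDiff_tube.continuous

/-- `z₂ ≠ 0` on the image of the tube. [folklore] -/
theorem pr₂_tube_ne_zero (p : S1) (w : E2) : pr₂ (tube (p, w) : E4) ≠ 0 := by
  rw [pr₂_tube]
  exact smul_ne_zero (tubeScale_pos w).ne' (ne_zero_of_mem_unit_sphere p)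

/-- `‖z₂ (tube (p, w))‖ = s(w)`. [folklore] -/
theorem norm_pr₂_tube (p : S1) (w : E2) : ‖pr₂ (tube (p, w) : E4)‖ = tubeScale w := by
  rw [pr₂_tube, norm_smul, norm_eq_of_mem_sphere p, mul_one, Real.norm_eq_abs,
    abs_of_pos (tubeScale_pos w)]

end SphereOpenBook

end Literature.Geometry.Symplectic
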